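import Summits.CriticalPhenomena.PercolationContinuityZ3.Theorems.PercNearOneGluingNoHeavyLowerTailKnQuestion8CoefficientwiseNoCoreSeries
import Summits.CriticalPhenomena.PercolationContinuityZ3.Theorems.PercNearOneGluingNoHeavyLowerTailKnQuestion8CoefficientwiseNoCoreBase
import HarnessLib

/-!
# Unconditional members of the NO-CORE class: chains of root-edge blocks — prim-lf-2 gen 55

Support file (`--supports stmt-CriticalPhenomena-4575`, closed), prover `prim-lf-2` (gen 55).  No definitions, no named facts, no sorries; standard axioms.
Memo `prim-lf-2/CW-TWOSOURCESYM-gen55.md` §3; parts: `…CoefficientwiseNoCoreSeries.lean` (series closure), `…CoefficientwiseNoCoreBase.lean` (base members),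
`…CoefficientwiseNoCoreDecoration.lean` (decorations).

`(E; x, y) ∈ 𝒩` iff `0 ≤ Σ_{s ⊆ E : ¬(y ∈ C_x(s) ∧ y ∈ C_x(E∖s))} (f(C_x s) − f(C_x(E∖s)))·(g(C_x s) − g(C_x(E∖s)))` for all monotone `f, g` (CONJECTURE NO-CORE, gen 46).
* `Coefficientwise.noCore_series_adj_far` — `(E₁; x, v) ∈ 𝒩` and `E₂ ∋` an edge `v–y` (pieces glued at the cut vertex `v`) ⇒ `(E₁ ∪ E₂; x, y) ∈ 𝒩`.
* `Coefficientwise.noCore_two_rootEdge_blocks` — **unconditional**: if `E₁` contains an edge `x–v` and `E₂` contains an edge `v–y` (the two pieces sharing only the cut vertex `v`;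
  both otherwise ARBITRARY finite multigraphs), then NO-CORE(y)[f,g] ≥ 0 on `E₁ ∪ E₂` for all monotone `f, g` — e.g. two arbitrary 2-connected graphs `H₁ ∋ xv`, `H₂ ∋ vy` glued at `v`.
  Iterating (`noCore_series`) gives every chain of such 'root-edge blocks', and `noCore_decoration` allows arbitrary blocks hung anywhere.
[cite: KozmaNitzan2024, Questions 8–9 (§5.5 p. 36) (context: the Question-8 pocket covariance programme)]
-/

namespace Summit.CriticalPhenomena.PercolationContinuityZ3.Theorems

open Finset Literature.Probability.Percolation

namespace Coefficientwise

variable {ι V : Type*} [Fintype ι] [DecidableEq ι]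

open Classical in
/-- **Series step with a root-edge block on the far side.**  Under the gluing hypotheses of `noCore_series`, if `(E₁; x, v) ∈ 𝒩` and some edge of `E₂` joins `v` to `y`, then
`(E₁ ∪ E₂; x, y) ∈ 𝒩`.  [cite: KozmaNitzan2024, Questions 8–9 (§5.5 p. 36) (context)] -/
theorem noCore_series_adj_far (ends : ι → Sym2 V) {E₁ E₂ : Finset ι} (hE : Disjoint E₁ E₂) {x v y : V}
    (hsep : ∀ e ∈ E₁, ∀ e' ∈ E₂, ∀ w : V, w ∈ ends e → w ∈ ends e' → w = v)
    (hx : ∀ e ∈ E₂, x ∉ ends e) (hy : ∀ e ∈ E₁, y ∉ ends e) (hyx : y ≠ x)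
    {e₂ : ι} (he₂ : e₂ ∈ E₂) (he₂vy : ends e₂ = s(v, y)) (hyv : y ≠ v)
    (h₁ : ∀ φ ψ : Set V → ℝ, Monotone φ → Monotone ψ →
      0 ≤ ∑ s ∈ E₁.powerset.filter (fun s : Finset ι => ¬ (v ∈ openCluster (ends '' (↑s : Set ι)) x ∧
            v ∈ openCluster (ends '' (↑(E₁ \ s) : Set ι)) x)),
        (φ (openCluster (ends '' (↑s : Set ι)) x) - φ (openCluster (ends '' (↑(E₁ \ s) : Set ι)) x)) *
          (ψ (openCluster (ends '' (↑s : Set ι)) x) - ψ (openCluster (ends '' (↑(E₁ \ s) : Set ι)) x)))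
    (f g : Set V → ℝ) (hf : Monotone f) (hg : Monotone g) :
    0 ≤ ∑ s ∈ (E₁ ∪ E₂).powerset.filter (fun s : Finset ι => ¬ (y ∈ openCluster (ends '' (↑s : Set ι)) x ∧
          y ∈ openCluster (ends '' (↑((E₁ ∪ E₂) \ s) : Set ι)) x)),
      (f (openCluster (ends '' (↑s : Set ι)) x) - f (openCluster (ends '' (↑((E₁ ∪ E₂) \ s) : Set ι)) x)) *
        (g (openCluster (ends '' (↑s : Set ι)) x) - g (openCluster (ends '' (↑((E₁ ∪ E₂) \ s) : Set ι)) x)) :=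
  noCore_series ends hE hsep hx hy hyx h₁
    (fun φ ψ hφ hψ => noCore_powerset_of_adj_root ends E₂ v y he₂ he₂vy hyv φ ψ hφ hψ) f g hf hg

open Classical in
/-- **Two root-edge blocks (unconditional).**  Let `E₁, E₂` be disjoint edge sets sharing only the vertex `v`, with `x` on no `E₂`-edge and `y ≠ x` on no `E₁`-edge; if `E₁` contains
an edge `x–v` (`v ≠ x`) and `E₂` an edge `v–y` (`y ≠ v`), then NO-CORE(y) holds on `E₁ ∪ E₂` for all monotone `f, g`.
[cite: KozmaNitzan2024, Questions 8–9 (§5.5 p. 36) (context)] -/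
theorem noCore_two_rootEdge_blocks (ends : ι → Sym2 V) {E₁ E₂ : Finset ι} (hE : Disjoint E₁ E₂) {x v y : V}
    (hsep : ∀ e ∈ E₁, ∀ e' ∈ E₂, ∀ w : V, w ∈ ends e → w ∈ ends e' → w = v)
    (hx : ∀ e ∈ E₂, x ∉ ends e) (hy : ∀ e ∈ E₁, y ∉ ends e) (hyx : y ≠ x)
    {e₁ : ι} (he₁ : e₁ ∈ E₁) (he₁xv : ends e₁ = s(x, v)) (hvx : v ≠ x)
    {e₂ : ι} (he₂ : e₂ ∈ E₂) (he₂vy : ends e₂ = s(v, y)) (hyv : y ≠ v)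
    (f g : Set V → ℝ) (hf : Monotone f) (hg : Monotone g) :
    0 ≤ ∑ s ∈ (E₁ ∪ E₂).powerset.filter (fun s : Finset ι => ¬ (y ∈ openCluster (ends '' (↑s : Set ι)) x ∧
          y ∈ openCluster (ends '' (↑((E₁ ∪ E₂) \ s) : Set ι)) x)),
      (f (openCluster (ends '' (↑s : Set ι)) x) - f (openCluster (ends '' (↑((E₁ ∪ E₂) \ s) : Set ι)) x)) *
        (g (openCluster (ends '' (↑s : Set ι)) x) - g (openCluster (ends '' (↑((E₁ ∪ E₂) \ s) : Set ι)) x)) :=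
  noCore_series_adj_far ends hE hsep hx hy hyx he₂ he₂vy hyv
    (fun φ ψ hφ hψ => noCore_powerset_of_adj_root ends E₁ x v he₁ he₁xv hvx φ ψ hφ hψ) f g hf hg

end Coefficientwise

end Summit.CriticalPhenomena.PercolationContinuityZ3.Theorems
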